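import Literature.AnabelianGeometry.AbsoluteAnabelian.AbsTopII.EllipticCuspidalizationComparisonPrime
import Literature.AnabelianGeometry.AbsoluteAnabelian.AbsTopII.BelyiCuspidalizationChainU

/-!
# [AbsTopII] Cor 3.7 / 3.8 over a class `𝒟` with the NF-rational opens READ INSIDE THE DATUM
# (`BelyiDatumModel`, `NFOpen`, `toBelyiModel`)

S. Mochizuki, *Topics in Absolute Anabelian Geometry II: Decomposition Groups and Endomorphisms*
[AbsTopII] (bib `MochizukiAbsTopII2013`; locators = PDF pages of the kurims manuscript
`paper:url-585b8d0ad0d9`), §3, Def 3.5 p. 71, Example 3.6 pp. 71–72, Corollary 3.7 pp. 72–73,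
Corollary 3.8 p. 74; [AbsTopI] (`MochizukiAbsTopI2012`) Def 4.2 (iii), Def 4.6.

Statements file, abc-iut-L4-t6 lineage ([AbsTopII] §3 typer of record).  The recorded typings of
Cor 3.7 / 3.8 in printed generality (`BelyiModel.Cor_3_7 / Cor_3_7′ / Cor_3_7″`, `BelyiModel.Cor_3_8`;
`AbsTopII/CuspidalizationComparison.lean` p407799, `…/BelyiCuspidalizationContent.lean` p432148,
`…/BelyiCuspidalizationChainU.lean`) carry the scheme side of a member `X` — "for every nonempty open
subscheme `U_X ⊆ X` defined over a number field, the natural surjection `Π_{U_X} ↠ Π`", the cusps of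
`U_X` — as FREE MODEL DATA (`BelyiModel.NFOpen`, `cuspOf`, `cuspsOf`), exactly as the frozen Cor 3.3
typing carried cores / double covers / settings (finding F-f067-1, repaired by abc-iut-L4-t4's
`EllipticDatumModel`, `AbsTopII/EllipticCuspidalizationComparisonPrime.lean` p434497); the schema
certificates of abc-iut-f-064 (p429725, p434894) exploit precisely that freedom (an NF-open whose
"cuspidalization" identifies points; a member with no NF-open).  This file is the Cor 3.7 / 3.8 twin
of the Cor 3.3 repair, OVER THE SAME DATUM MODEL: `BelyiDatumModel 𝒟 extends EllipticDatumModel 𝒟`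
(flags `IsFinEt` / `IsOpenImmersion` with their group-theoretic laws, the cusps of the objects) by the
two printed flags of §3 it needs — "of strictly Belyi type" (Def 3.5) and "defined over a number field"
(Cor 3.7: "nonempty open subscheme `U_X ⊆ X` defined over a number field") — and:

* `NFOpen b X` — an NF-rational open of `X` INSIDE THE DATUM: a datum object `U` flagged defined over a
  number field with a datum open immersion `ι : U → X` and a representative `ψ` of `[π₁(ι)]`; its
  `cuspidalization` is `ψ : Π_U ↠ Π` (surjective by the `IsOpenImmersion` law, over `G`), its cusps are
  the model's cusps of `U` (`M.cusps b U`);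
* `toBelyiModel` — the `BelyiModel` INDUCED by a datum model (NF-opens := datum NF-opens,
  `cuspOf := cuspidalization`, `cuspsOf U :=` the cusps of `U`); through it every predicate /
  certificate over `BelyiModel` (abc-iut-f-064's schema files included) applies verbatim;
NO NEW `Prop` FACT is declared (review of p438873, D-0026): the datum forms of Cor 3.7 / 3.8 ARE the
existing named facts applied to the induced model — consumers take `(h : M.toBelyiModel.Cor_3_7'')`
(`BelyiCuspidalizationChainU.lean`: for every member with the standing hypotheses
`BelyiModel.IsCor37Member` and every DATUM NF-open `(U, ι, ψ)`, some `BelyiCuspidalization` of `Π ↠ G` is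
isomorphic over `Π` to `ψ : Π_U ↠ Π` (b), has the images of the cusps of `U` as its removed-point
decomposition groups (c), and realizes a genuine `Π`-chain whose last `m` •'s compute its `Π_U ↠ Π_V`
(a)) and `(h : M.toBelyiModel.Cor_3_8)` (`CuspidalizationComparison.lean`: the bi-anabelian form, `U_{X₂}`
ranging over the datum NF-opens of `X₂`); the spelled-out unfoldings are `Iff.rfl` theorems of the
proof-only companion `BelyiCuspidalizationDatumProofs.lean`.
Nothing of the earlier files is edited; `BelyiModel` stays as the free-data interface, now fed by data.
(Advisory of the review: print's "nonempty open subscheme" — `NFOpen` carries no nonemptiness flag, as the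
parent `BelyiModel.NFOpen` carries none; to be added when the datum grows one. -- TODO(general form))  Drafted for an
L4-lead ruling («COR37-DATUM-RETYPE»); HONEST FRAMING: predicates on a MODEL INTERFACE the tree does
not instantiate (étale `π₁`); the flags are primitive; "`U_X` is THE complement of the constructed
points" is not expressible over the datum (as in (iii′) of the Cor 3.3 repair); typed ≠ proved; nothing
here bears on [IUTchIII] Cor 3.12.
-/

noncomputable section

open CategoryTheory Topology
open scoped Pointwise

universe u

namespace Literature.AnabelianGeometry.AbsoluteAnabelian.AbsTopII

open Literature.AlgebraicGeometry.Frobenioids (IsSlimGroup)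
open FundamentalExtension
open AbsTopI (ConstructionDataClass)
open AugmentedProfiniteGrp

variable {𝒟 : ConstructionDataClass.{u}}

/-! ### The model interface: the Cor 3.3 datum model plus the two flags of §3 -/

/-- MODEL INTERFACE (shape (M)) for Cor 3.7 / 3.8 over a class `𝒟`, v3: abc-iut-L4-t4's
`EllipticDatumModel` (flags "finite étale" / "open immersion" on datum morphisms with their laws,
the cusps of the objects) extended by "`X` is of strictly Belyi type" (Def 3.5 p. 71: "defined over a
number field and isogenous to a hyperbolic orbicurve of Belyi type") and "defined over a number field"
(Cor 3.7 p. 73), both `Prop`-valued primitive flags on datum objects.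
[cite: MochizukiAbsTopII2013, Cor 3.7 pp.72-73] -/
structure BelyiDatumModel (𝒟 : ConstructionDataClass.{u}) extends EllipticDatumModel 𝒟 where
  /-- Def 3.5: "`X` is [a hyperbolic orbicurve] of strictly Belyi type" -/
  IsStrictlyBelyiType : ∀ b : 𝒟.Base, (𝒟.datum b).Obj → Prop
  /-- "defined over a number field" (an object `U` over `k_b` with `U ≅ U_F ×_F k_b`, `F` a number field) -/
  IsDefinedOverNF : ∀ b : 𝒟.Base, (𝒟.datum b).Obj → Prop

namespace BelyiDatumModel

variable (M : BelyiDatumModel 𝒟)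

/-- **"a nonempty open subscheme `U_X ⊆ X` defined over a number field"** (Cor 3.7 p. 73) INSIDE THE
DATUM: a datum object `U` defined over a number field, a datum open immersion `ι : U → X`, and a
representative `ψ` of "the natural surjection `Π_{U_X} := π₁(U_X) ↠ π₁(X)`" `= [π₁(ι)]`.
[cite: MochizukiAbsTopII2013, Cor 3.7 p.73] -/
structure NFOpen (b : 𝒟.Base) (X : (𝒟.datum b).Obj) : Type u where
  /-- the open subscheme `U_X`, as a datum object -/
  U : (𝒟.datum b).Obj
  /-- `U_X ↪ X` -/
  ι : (𝒟.datum b).Hom U X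
  /-- `ι` is an open immersion -/
  isOpenImmersion : M.IsOpenImmersion ι
  /-- `U_X` is defined over a number field -/
  definedOverNF : M.IsDefinedOverNF b U
  /-- a representative of `[π₁(ι)] : Π_{U_X} ↠ Π` -/
  ψ : HomOver ((𝒟.datum b).grp U) ((𝒟.datum b).grp X)
  /-- it represents `[π₁(ι)]` -/
  mk_ψ : OuterHom.mk ψ = (𝒟.datum b).outerHom ι

namespace NFOpen

variable {M} {b : 𝒟.Base} {X : (𝒟.datum b).Obj}

/-- "the natural surjection `Π_{U_X} ↠ Π` — i.e., 'cuspidalization' of `Π`" of a datum NF-open, in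
the `Cuspidalization` format of `BelyiCuspidalization.lean` (surjective by the open-immersion law;
over `G`, Galois component the identity). [cite: MochizukiAbsTopII2013, Cor 3.7 p.73] -/
def cuspidalization (O : M.NFOpen b X) : Cuspidalization ((𝒟.datum b).ext X) :=
  ⟨(𝒟.datum b).ext O.U, O.ψ.toExtensionHom,
    M.isOpenImmersion_surjective O.ι O.isOpenImmersion O.ψ O.mk_ψ, Function.bijective_id⟩

end NFOpen

/-! ### The induced `BelyiModel` (Cor 3.7 / 3.8 with datum-internal opens = its `Cor_3_7''` / `Cor_3_8`) -/

/-- The `BelyiModel` (interface of `CuspidalizationComparison.lean`) INDUCED by a datum model: cusps and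
"strictly Belyi type" as flagged, the NF-rational opens = the datum NF-opens `(U, ι, ψ)`, their
cuspidalizations `ψ : Π_U ↠ Π`, their cusps = the model's cusps of `U`.  Through it every predicate and
certificate stated over `BelyiModel` applies to datum models. [cite: MochizukiAbsTopII2013, Cor 3.7 p.73] -/
def toBelyiModel : BelyiModel 𝒟 where
  cusps := M.cusps
  IsStrictlyBelyiType := M.IsStrictlyBelyiType
  NFOpen := M.NFOpen
  cuspOf := fun O => O.cuspidalization
  cuspsOf := fun O => M.cusps _ O.U

end BelyiDatumModel

/-! ### Erratum to the `BelyiDatumModel` docstring (ref-f PASS F17, finding F17-1; doc-only) -/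

namespace BelyiDatumModel

/-- ERRATUM (referee lane f, PASS F17, finding F17-1 — DOC-ONLY): the docstring of `BelyiDatumModel` above
renders Def 3.5 in quotation marks as "defined over a number field and isogenous to a hyperbolic orbicurve
of Belyi type".  Print, Def 3.5 p. 71 l. 6–8, reads VERBATIM: "We shall say that `X` is of *strictly Belyi
type* if it is defined over a number field and isogenous [cf. §0] to a hyperbolic curve of genus zero.
[Thus, this definition generalizes the definition of [Mzk14], Definition 2.3, (i).]" — the in-quote wording
of the frozen docstring conflates Def 3.5 with the [Mzk14] notion it generalizes.  The flag
`IsStrictlyBelyiType` is PRIMITIVE (no typed content), so nothing typed changes; the frozen docstring cannot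
be edited in place (append-only), hence this note, anchored on the `rfl` fact that the induced free-data
model carries the same flag. [cite: MochizukiAbsTopII2013, Def 3.5 p.71] -/
theorem toBelyiModel_isStrictlyBelyiType (M : BelyiDatumModel 𝒟) :
    M.toBelyiModel.IsStrictlyBelyiType = M.IsStrictlyBelyiType := rfl

end BelyiDatumModel

end Literature.AnabelianGeometry.AbsoluteAnabelian.AbsTopII
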